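import Summits.CriticalPhenomena.PercolationContinuityZ3.Theorems.PercNecklaceBackboneTruncatedSusceptibilityFiniteOfThetaOfCritical
import Summits.CriticalPhenomena.PercolationContinuityZ3.Theorems.PercNecklaceBackboneTruncatedSusceptibilityFiniteOfThetaOfBlockingSum
import Summits.CriticalPhenomena.PercolationContinuityZ3.Theorems.PercNecklaceBackboneTruncatedSusceptibilityFiniteOfThetaOfSupercriticalLimit
import Summits.CriticalPhenomena.PercolationContinuityZ3.Theses.PercTruncatedSusceptibility
import Literature.Barriers.CriticalPhenomena.SameDensityLocalUniqueness
import Literature.Barriers.CriticalPhenomena.SprinklingRenormalisationProofs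
import Literature.Probability.Percolation.AnchoredProfileVanishing
import Literature.Probability.Percolation.HalfSpaceProofs
import HarnessLib

/-!
# Strategy census (crux-strategist s2) for crux `TruncatedSusceptibilityFiniteOfTheta`
# (stmt-CriticalPhenomena-0852) — typed companion of `STRATEGY-CENSUS.md`

NOT a registered line, NOT a filed split: this file only TYPES the four language switches of the
strategist protocol (transfer / strengthen / decomposition / negation) over existing declarations and
proves the cheap logical facts that show why each gives no leverage short of the conjunct
`PercolationContinuityZ3` (`S`). Crux `L` (three identical route spellings; here the
`PercNecklaceBackbone` one, `crux_spelling_home` ties the home route):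

  `L : ∀ p, θ(p) > 0 → Σ_x P_p(0 ↔ x, |C(0)| < ∞) < ∞`,   `L ⟺ (J → χᶠ(p_c) < ∞)` (p150587),
  `J := 0 < θ(p_c)` (the jump world, `J ↔ ¬S`).

* §0 names and the two landed logical facts `S → L`, `L ↔ (J → χᶠ(p_c) < ∞)`.
* §1 TRANSFER: the `ℤ³ / p_c` analogue of the sprinkling-free input of Hermon–Hutchcroft
  (arXiv:1904.10448, Prop. 2.4: `E_p[𝒫(S → ∞)] ≥ c|E(S)|`, "the only place where nonamenability is
  used") in its only non-trivial amenable form (surface order, `BoxFluxLower`), next to the PROVED fact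
  that kills it at `p_c(ℤ³)` unconditionally: the half-space one-arm vanishes
  (`halfSpaceReach_tendsto_zero_criticalProbI`, Barsky–Grimmett–Newman, in tree).
* §2 STRENGTHEN: four typed `S⁺` — uniform supercritical domination (`SupChiNearCritical`, radius form =
  hypothesis of the landed `stub_criticalRadiusMoment_of_supercriticalDomination`), exponential radius
  decay at a percolating `p_c` (`ExpRadiusDecayAtCritical`, = crux 0853 at `p_c`), same-`p` local
  uniqueness (`SPlusLocalUniqueness`) and same-`p` slab percolation (`SPlusSamePSlab`); the last two are
  PROVED equivalent to `S` by tree theorems (`sPlusLocalUniqueness_iff_summit`, `sPlusSamePSlab_iff_summit`).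
* §3 DECOMPOSITION: the best typed split `SubBlockingSummable ∧ SubGluing → L` (`crux_of_subs`), the
  proof that it is a conjunct split (`crux_iff_subs`), and the proof that modulo the believed
  unconditional input `Σ_n u_n(p_c) = ∞` its first piece is ALREADY the conjunct
  (`subBlockingSummable_iff_summit_of_not_summable_blocking`) while the second is then vacuous
  (`subGluing_of_not_summable_blocking`).
* §4 NEGATION: the counterexample structure `¬L ↔ J ∧ χᶠ(p_c) = ∞` (`not_crux_iff`), `¬L → ¬S`
  (`not_summit_of_not_crux`), and the typed obstruction `N4 := J → χᶠ(p_c) = ∞` with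
  `N4 → (L ↔ S)` (`crux_iff_summit_of_n4`) and `H → N4` (`n4_of_H`, H = crux stmt-0850).
-/

noncomputable section

namespace Summit.CriticalPhenomena.PercolationContinuityZ3.Cruxes.TruncatedSusceptibilityFiniteOfTheta.StrategyCensus

open MeasureTheory Filter Topology
open Literature.Probability.Percolation Literature.Probability.LatticeModels
open Literature.Barriers.CriticalPhenomena
open Summit.CriticalPhenomena.PercolationContinuityZ3.Theorems.SubpolynomialBlocking.Negative (blockProb)
open Summit.CriticalPhenomena.PercolationContinuityZ3.Theorems.TruncatedSusceptibilityFiniteOfTheta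

/-! ## §0 Names -/

/-- The crux, by name (route spelling `PercNecklaceBackbone`, the one the landed theorems use). -/
abbrev Crux : Prop :=
  Summit.CriticalPhenomena.PercolationContinuityZ3.Theses.PercNecklaceBackbone.TruncatedSusceptibilityFiniteOfTheta

/-- The home-route spelling (`PercTruncatedSusceptibility`, shared item, identical text). -/
theorem crux_spelling_home :
    Crux ↔ Summit.CriticalPhenomena.PercolationContinuityZ3.Theses.PercTruncatedSusceptibility.TruncatedSusceptibilityFiniteOfTheta :=
  Iff.rfl

/-- `J`: the jump hypothesis `θ(p_c) > 0` on `ℤ³`. -/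
def Jump : Prop := 0 < theta (zdGraph 3) (0 : Site 3) (criticalProbI 3)

/-- `χᶠ(p_c) < ∞` in the crux's spelling. -/
def ChiFiniteCritical : Prop :=
  Summable fun x : Site 3 => (bondPercolation (zdGraph 3) (criticalProbI 3)).real (openConn 0 x \ percolatesAt 0)

/-- `J ↔ ¬S`. -/
theorem jump_iff_not_summit : Jump ↔ ¬ _root_.PercolationContinuityZ3 := by
  refine ⟨fun hJ hS => hJ.ne' hS, fun hS => lt_of_le_of_ne measureReal_nonneg (Ne.symm hS)⟩

/-- `L ↔ (J → χᶠ(p_c) < ∞)` (p150587, by name). -/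
theorem crux_iff_jump_imp : Crux ↔ (Jump → ChiFiniteCritical) :=
  TruncatedSusceptibilityFiniteOfTheta_iff_critical

/-- `S → L` (p153838, by name). -/
theorem crux_of_summit (hS : _root_.PercolationContinuityZ3) : Crux :=
  TruncatedSusceptibilityFiniteOfTheta_of_percolationContinuity hS

/-! ## §1 Transfer — the sprinkling-free nonamenable input, transplanted to `ℤ³` at `p_c` -/

/-- **`BoxFluxLower`** — the surface-order `ℤ³ / p_c` analogue of Hermon–Hutchcroft's Prop. 2.4
(`E_p[𝒫_ω(S → ∞)] ≥ c_p |E(S)|` for finite `S` in a NONAMENABLE transitive graph): under `J`, the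
expected number of vertices on the outer face `Λ_{n+1} ∖ Λ_n` joined to infinity by an open path avoiding
every edge that touches `Λ_n` is at least `c (n+1)²`. (The volume-order form `≥ c |Λ_n|` is false on every
amenable graph at every `p`, Hermon–Hutchcroft Cor. 3.5; this is the strongest form that is not trivially
false on `ℤ³`.) The census shows it is FALSE at `p_c(ℤ³)` even under `J`: a last-exit decomposition bounds
the left side by `6 (2n+3)² · P_{p_c}(halfSpaceReach ⌊εn⌋) + C ε (n+1)²`, which is `o(n²)` by
`halfSpaceReach_tendsto_zero_criticalProbI`. -/
def BoxFluxLower : Prop :=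
  Jump → ∃ c : ℝ, 0 < c ∧ ∀ n : ℕ,
    c * ((n : ℝ) + 1) ^ 2 ≤
      ∑ x ∈ (box 3 (n + 1)).filter (fun y => y ∉ box 3 n),
        (bondPercolation (zdGraph 3) (criticalProbI 3)).real
          {ω | {e ∈ ω | ∀ v ∈ e, v ∉ box 3 n} ∈ percolatesAt x}

/-- **The fact that kills the transfer, in tree and unconditional**: at `p_c(ℤ³)` the probability that
the origin is joined inside the half-space `{0 ≤ x₀}` to height `n` tends to `0`
(Barsky–Grimmett–Newman `θ_ℍ(p_c) = 0`, proved as `BarskyGrimmettNewman1991_Z3_holds`, and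
`tendsto_measure_halfSpaceReach`). No `J` needed — so no sprinkling-free "positive flux through the
boundary at linear scale" survives at `p_c`, with or without an infinite cluster. -/
theorem halfSpaceReach_tendsto_zero_criticalProbI :
    Tendsto (fun n => bondPercolation (zdGraph 3) (criticalProbI 3) (CerfDembinVanishing.halfSpaceReach 3 n)) atTop (𝓝 0) :=
  CerfDembinVanishing.tendsto_measure_halfSpaceReach (d := 3) (criticalProbI 3) BarskyGrimmettNewman1991_Z3_holds

/-! ## §2 Strengthen — four typed `S⁺` -/

/-- **S⁺₁ (uniform truncated susceptibility just above `p_c`, volume form).** Under `J` there are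
`δ > 0` and `M` with `χᶠ(p) ≤ M` for all `p ∈ (p_c, p_c + δ)`; by lower semicontinuity of
`p ↦ P_p(0 ↔ x, |C| < ∞)` and Fatou this gives `χᶠ(p_c) ≤ M`, hence the crux. Its radius analogue is
the hypothesis of the landed `stub_criticalRadiusMoment_of_supercriticalDomination` (p154083); the census
records why it is believed FALSE (`χᶠ(p) → ∞` as `p ↓ p_c` in a jump world too: cap c1-d). -/
def SupChiNearCritical : Prop :=
  Jump → ∃ δ : ℝ, 0 < δ ∧ ∃ M : ℝ, ∀ p : unitInterval,
    criticalProb (zdGraph 3) (0 : Site 3) < (p : ℝ) → (p : ℝ) < criticalProb (zdGraph 3) (0 : Site 3) + δ →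
      (Summable fun x : Site 3 => (bondPercolation (zdGraph 3) p).real (openConn 0 x \ percolatesAt 0)) ∧
        (∑' x : Site 3, (bondPercolation (zdGraph 3) p).real (openConn 0 x \ percolatesAt 0)) ≤ M

/-- **S⁺₂ (exponential radius decay at a percolating `p_c`)** = the `p_c` instance of crux 0853
`FiniteRadiusExpDecayOfTheta`; strictly stronger than the registered stub's `RM(p_c)`, same wall. -/
def ExpRadiusDecayAtCritical : Prop :=
  Jump → ∃ c : ℝ, 0 < c ∧ ∀ n : ℕ,
    (bondPercolation (zdGraph 3) (criticalProbI 3)).real (siteToBoundary 3 n \ percolatesAt 0) ≤ Real.exp (-(c * n))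

/-- **S⁺₃ (same-`p` local uniqueness)**: at every percolating `p`, Kesten–Zhang's clause (b) is small at
large scales — the rigidity every static renormalisation towards `χᶠ < ∞` needs. -/
def SPlusLocalUniqueness : Prop :=
  ∀ p : unitInterval, 0 < theta (zdGraph 3) (0 : Site 3) p →
    ∀ ε : ℝ, 0 < ε → ∃ N₁ : ℕ, ∀ N₀ : ℕ, N₁ ≤ N₀ →
      (bondPercolation (zdGraph 3) p).real (KestenZhang.TwoArms (d := 3) N₀) ≤ ε

/-- **S⁺₃ is the conjunct** (barrier `SameDensityLocalUniqueness`, proved in tree). -/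
theorem sPlusLocalUniqueness_iff_summit : SPlusLocalUniqueness ↔ _root_.PercolationContinuityZ3 :=
  twoArmsSmallOfTheta_iff_percolationContinuityZ3

/-- **S⁺₄ (same-`p` slab percolation)**: percolation of `ℤ³` at `p` forces percolation of some slab
`S_k` at the SAME `p` — what Grimmett–Marstrand "with `η = 0`" would give; it yields `χᶠ(p) < ∞` by
the slab technology at every percolating `p`. -/
def SPlusSamePSlab : Prop :=
  ∀ p : unitInterval, 0 < theta (zdGraph 3) (0 : Site 3) p →
    ∃ k : ℕ, 0 < k ∧ 0 < theta (slabGraph 3 k) (slabOrigin 3 k) p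

/-- **S⁺₄ is the conjunct** (barrier `SprinklingRenormalisation`, audit theorem, unconditional). -/
theorem sPlusSamePSlab_iff_summit : SPlusSamePSlab ↔ _root_.PercolationContinuityZ3 :=
  percolationContinuity_iff_samePSlab_holds.symm

/-! ## §3 Decomposition — the best typed split and why one piece stays the whole crux -/

/-- **Sub₁ (hole tails of the infinite cluster).** Under `J`, critical annulus blocking is summable:
`Σ_n u_n(p_c) < ∞`, `u_n = P_{p_c}(no open crossing of Λ_{2n} ∖ Λ_n inside Λ_{2n})`. -/
def SubBlockingSummable : Prop := Jump → Summable fun n : ℕ => blockProb 3 (criticalProbI 3) n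

/-- **Sub₂ (gluing).** Under `J` AND summable critical blocking, finite clusters at `p_c` are thin. -/
def SubGluing : Prop := Jump → (Summable fun n : ℕ => blockProb 3 (criticalProbI 3) n) → ChiFiniteCritical

/-- The assembly of the split (modus ponens through `L ⟺ L(p_c)`). -/
theorem crux_of_subs (h₁ : SubBlockingSummable) (h₂ : SubGluing) : Crux :=
  crux_iff_jump_imp.mpr fun hJ => h₂ hJ (h₁ hJ)

/-- Sub₁ is a consequence of the crux (radius quarantine sandwich, p158555/p158780). -/
theorem subBlockingSummable_of_crux (h : Crux) : SubBlockingSummable := fun hJ =>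
  summable_blockProb_of_truncatedSusceptibility (criticalProbI 3) hJ (crux_iff_jump_imp.mp h hJ)

/-- Sub₂ is a consequence of the crux (trivially). -/
theorem subGluing_of_crux (h : Crux) : SubGluing := fun hJ _ => crux_iff_jump_imp.mp h hJ

/-- So the split is a conjunct split: `L ↔ Sub₁ ∧ Sub₂`. -/
theorem crux_iff_subs : Crux ↔ SubBlockingSummable ∧ SubGluing :=
  ⟨fun h => ⟨subBlockingSummable_of_crux h, subGluing_of_crux h⟩, fun h => crux_of_subs h.1 h.2⟩

/-- **Modulo the believed unconditional input `Σ_n u_n(p_c) = ∞`, Sub₁ is already the conjunct.** -/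
theorem subBlockingSummable_iff_summit_of_not_summable_blocking
    (hU : ¬ Summable fun n : ℕ => blockProb 3 (criticalProbI 3) n) :
    SubBlockingSummable ↔ _root_.PercolationContinuityZ3 := by
  constructor
  · intro h₁
    by_contra hS
    exact hU (h₁ (jump_iff_not_summit.mpr hS))
  · intro hS hJ
    exact absurd hS (jump_iff_not_summit.mp hJ)

/-- **… and Sub₂ is then vacuous.** -/
theorem subGluing_of_not_summable_blocking
    (hU : ¬ Summable fun n : ℕ => blockProb 3 (criticalProbI 3) n) : SubGluing :=
  fun _ hsum => absurd hsum hU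

/-! ## §4 Negation — the counterexample structure and the typed obstruction -/

/-- **A counterexample to `L` is exactly a jump world with `χᶠ(p_c) = ∞`.** -/
theorem not_crux_iff : ¬ Crux ↔ Jump ∧ ¬ ChiFiniteCritical := by
  rw [crux_iff_jump_imp]
  constructor
  · intro h
    by_cases hJ : Jump
    · exact ⟨hJ, fun hχ => h fun _ => hχ⟩
    · exact absurd (fun hJ' => absurd hJ' hJ) h
  · rintro ⟨hJ, hχ⟩ h
    exact hχ (h hJ)

/-- **`¬L → ¬S`**: refuting the crux refutes the conjunct (contrapositive of `S → L`), so no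
counterexample can be built short of disproving `θ(p_c) = 0`. -/
theorem not_summit_of_not_crux (h : ¬ Crux) : ¬ _root_.PercolationContinuityZ3 :=
  fun hS => h (crux_of_summit hS)

/-- **N4** — the typed obstruction met by the counterexample attempt: in a jump world the truncated
susceptibility at `p_c` is infinite. -/
def N4 : Prop := Jump → ¬ ChiFiniteCritical

/-- **`N4` makes the crux the conjunct.** -/
theorem crux_iff_summit_of_n4 (hN : N4) : Crux ↔ _root_.PercolationContinuityZ3 := by
  constructor
  · intro hL
    by_contra hS
    have hJ := jump_iff_not_summit.mpr hS
    exact hN hJ (crux_iff_jump_imp.mp hL hJ)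
  · exact crux_of_summit

/-- **`N4` is implied by the OTHER crux of the home route** (`CritTruncatedSusceptibilityInfinite`,
stmt-CriticalPhenomena-0850: `χᶠ(p_c) = ∞` unconditionally) — so filing `N4` as a stub would re-file
crux 0850 under this crux; it is not this seat's to plan. -/
theorem n4_of_H
    (hH : Summit.CriticalPhenomena.PercolationContinuityZ3.Theses.PercTruncatedSusceptibility.CritTruncatedSusceptibilityInfinite) :
    N4 :=
  fun _ hχ => hH hχ

end Summit.CriticalPhenomena.PercolationContinuityZ3.Cruxes.TruncatedSusceptibilityFiniteOfTheta.StrategyCensus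

end
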